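import Summits.ResolutionOfSingularities.ResolutionOfSingularities.Theorems.FrobeniusLadderFRationalResolutionBlowupRegularZariskiLocal
import Mathlib.RingTheory.Localization.Away.Basic
import HarnessLib

/-!
# Crux `FrobeniusLadder.FRationalResolution` (stmt-ResolutionOfSingularities-15317), line `redirect`,
# stub `stub_diagonalizableQuotientResolution` — the blow-up of a centre assembled from FINITELY MANY PRIMARY PIECES at
# distinct closed points is regular as soon as each piece is, locally (Galois route: the Galois-stable centre on
# `B ⊗_K K'` is the intersection of the centres at the points over `𝔭`)

Generic. `B` Noetherian, `J ⊆ B`.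

* `isRegular_affineBlowup_map_of_mem` — off the centre nothing happens: for `g ∈ J`, `Bl_{J B_g}(Spec B_g)` is regular
  as soon as `Spec B` is regular at the primes not containing `J` (`π` is an isomorphism over `D(g)`,
  `affineBlowup.isIso_morphismRestrict`);
* **`isRegular_affineBlowup_of_forall_maximal_le`** — `Bl_J(Spec B)` is regular if `Spec B` is regular off `V(J)` and every
  MAXIMAL `𝔪 ⊇ J` has some `g ∉ 𝔪` with `Bl_{J B_g}` regular (`…BlowupRegularZariskiLocal`);
* `map_iInf_eq_map_of_forall_mem` — for `J = ⨅ᵢ Iᵢ` and `g ∈ I_j` for all `j ≠ i`: `J B_g = Iᵢ B_g`;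
* **`isRegular_affineBlowup_iInf`** — `Iᵢ` with `𝔔ᵢⁿ ⊆ Iᵢ ⊆ 𝔔ᵢ` at finitely many maximal ideals `𝔔ᵢ`, `Spec B` regular at
  every prime `≠ 𝔔ᵢ`, and for each `i` some `g ∉ 𝔔ᵢ` lying in every other `I_j` with `Bl_{Iᵢ B_g}` regular
  ⇒ `Bl_{⨅ Iᵢ}(Spec B)` is regular.

Honest label: generic plumbing (no stub closed by name). No definitions, no named facts, no sorry.
[cite: StacksProject, Tag 02OS; Tag 02NS] [cite: GortzWedhorn2020, Prop. 13.91 (2)]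
-/

noncomputable section

-- single-problem summit: the doubled namespace component is forced
set_option linter.dupNamespace false

open CategoryTheory AlgebraicGeometry TopologicalSpace
open Literature.AlgebraicGeometry.Resolution
open Summit.ResolutionOfSingularities.ResolutionOfSingularities.Theorems.FRationalResolution

namespace Summit.ResolutionOfSingularities.ResolutionOfSingularities.Theorems.FRationalResolution.BlowupComaximalCentres

/-- **Off the centre nothing happens.** Let `g ∈ J ⊆ B` and suppose `Spec B` is regular at every prime not containing
`J`. Then `Bl_{J B_g}(Spec B_g)` is regular: `J B_g` contains the unit `g`, so `π : Bl → Spec B_g` is an isomorphism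
(over `D(g) = Spec B_g`), and `Spec B_g ⊆ Spec B ∖ V(J)` is regular. [cite: StacksProject, Tag 02OS] -/
theorem isRegular_affineBlowup_map_of_mem {B : Type} [CommRing B] (J : Ideal B)
    (hoff : ∀ x : Spec (.of B), ¬ J ≤ x.asIdeal → x ∈ Scheme.regularLocus (Spec (.of B)))
    {g : B} (hg : g ∈ J) :
    Scheme.IsRegular (affineBlowup (J.map (algebraMap B (Localization.Away g)))) := by
  set L := Localization.Away g with hL
  set J' : Ideal L := J.map (algebraMap B L) with hJ'
  -- `Spec B_g` is regular
  haveI : IsOpenImmersion (Spec.map (CommRingCat.ofHom (algebraMap B L))) := IsOpenImmersion.of_isLocalization g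
  have hregL : Scheme.IsRegular (Spec (.of L)) := by
    intro z
    have hz := (mem_regularLocus_iff_of_flat_of_isPreimmersion (Spec.map (CommRingCat.ofHom (algebraMap B L))) z).mpr
    refine (Scheme.mem_regularLocus z).mp (hz (hoff _ fun hle => ?_))
    -- `g ∉` the image prime, since `g` is a unit in `L`
    have hgz : algebraMap B L g ∈ z.asIdeal := by
      have := hle hg
      exact this
    exact z.isPrime.ne_top (Ideal.eq_top_of_isUnit_mem _ hgz (IsLocalization.Away.algebraMap_isUnit g))
  -- `π` is an isomorphism over `D(g/1) = everything`
  set π := affineBlowup.π J' with hπ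
  have hgJ' : algebraMap B L g ∈ J' := Ideal.mem_map_of_mem _ hg
  set U : (Spec (.of L)).Opens := PrimeSpectrum.basicOpen (algebraMap B L g) with hU
  haveI : IsIso (π ∣_ U) := affineBlowup.isIso_morphismRestrict (I := J') (algebraMap B L g) hgJ'
  -- the open piece `π⁻¹ U` is regular (it is isomorphic to the open `U ⊆ Spec L`)
  let j : ((π ⁻¹ᵁ U : (affineBlowup J').Opens) : Scheme.{0}) ⟶ Spec (.of L) := (π ⁻¹ᵁ U).ι ≫ π
  have hj : j = (π ∣_ U) ≫ U.ι := (morphismRestrict_ι π U).symm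
  haveI : IsOpenImmersion j := by rw [hj]; infer_instance
  have hregU : Scheme.IsRegular ((π ⁻¹ᵁ U : (affineBlowup J').Opens) : Scheme.{0}) :=
    Scheme.IsRegular.of_isOpenImmersion j hregL
  -- every point of the blow-up lies in `π⁻¹ U`
  intro y
  have hyU' : (π y : PrimeSpectrum L) ∈ PrimeSpectrum.basicOpen (algebraMap B L g) :=
    (PrimeSpectrum.mem_basicOpen _ _).mpr fun hmem => (π y).isPrime.ne_top
      (Ideal.eq_top_of_isUnit_mem _ hmem (IsLocalization.Away.algebraMap_isUnit g))
  have hyU : y ∈ π ⁻¹ᵁ U := hyU'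
  have h1 : (⟨y, hyU⟩ : (π ⁻¹ᵁ U : (affineBlowup J').Opens)) ∈
      Scheme.regularLocus ((π ⁻¹ᵁ U : (affineBlowup J').Opens) : Scheme.{0}) :=
    (Scheme.mem_regularLocus _).mpr (hregU _)
  have h2 := (mem_regularLocus_iff_of_flat_of_isPreimmersion (π ⁻¹ᵁ U).ι ⟨y, hyU⟩).mp h1
  rw [Scheme.Opens.ι_apply] at h2
  exact (Scheme.mem_regularLocus y).mp h2

/-- **`Bl_J(Spec B)` is regular if it is so near the maximal ideals containing `J` and `Spec B` is regular off `V(J)`.**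
[cite: StacksProject, Tag 02OS] [cite: GortzWedhorn2020, Prop. 13.91 (2)] -/
theorem isRegular_affineBlowup_of_forall_maximal_le {B : Type} [CommRing B] [IsNoetherianRing B] (J : Ideal B)
    (hoff : ∀ x : Spec (.of B), ¬ J ≤ x.asIdeal → x ∈ Scheme.regularLocus (Spec (.of B)))
    (hon : ∀ (𝔪 : Ideal B) [𝔪.IsMaximal], J ≤ 𝔪 → ∃ g : B, g ∉ 𝔪 ∧
      Scheme.IsRegular (affineBlowup (J.map (algebraMap B (Localization.Away g))))) :
    Scheme.IsRegular (affineBlowup J) := by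
  refine BlowupRegularZariskiLocal.isRegular_affineBlowup_of_forall_maximal_exists_away J fun 𝔪 h𝔪 => ?_
  by_cases hJ𝔪 : J ≤ 𝔪
  · exact hon 𝔪 hJ𝔪
  · obtain ⟨g, hgJ, hg𝔪⟩ := SetLike.not_le_iff_exists.mp hJ𝔪
    exact ⟨g, hg𝔪, isRegular_affineBlowup_map_of_mem J hoff hgJ⟩

/-- **Localizing an intersection at an element of all but one piece.** If `g ∈ I_j` for every `j ≠ i`, then
`(⨅ I) B_g = I_i B_g` (for `x ∈ I_i`, `x/1 = (x g)/g` with `x g ∈ ⨅ I`). [folklore] -/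
theorem map_iInf_eq_map_of_forall_mem {B : Type} [CommRing B] {ι : Type} [Fintype ι] [DecidableEq ι]
    (I : ι → Ideal B) (i : ι) {g : B} (hg : ∀ j, j ≠ i → g ∈ I j) :
    (⨅ j, I j).map (algebraMap B (Localization.Away g)) = (I i).map (algebraMap B (Localization.Away g)) := by
  refine le_antisymm (Ideal.map_mono (iInf_le I i)) ?_
  rw [Ideal.map_le_iff_le_comap]
  intro x hx
  rw [Ideal.mem_comap]
  have hxg : x * g ∈ ⨅ j, I j := by
    refine Ideal.mem_iInf.mpr fun j => ?_
    by_cases hj : j = i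
    · subst hj; exact Ideal.mul_mem_right _ _ hx
    · exact Ideal.mul_mem_left _ _ (hg j hj)
  obtain ⟨u, hu⟩ := IsLocalization.Away.algebraMap_isUnit (S := Localization.Away g) g
  have hx' : algebraMap B (Localization.Away g) x =
      algebraMap B (Localization.Away g) (x * g) * ↑u⁻¹ := by
    rw [map_mul, ← hu, mul_assoc, Units.mul_inv, mul_one]
  rw [hx']
  exact Ideal.mul_mem_right _ _ (Ideal.mem_map_of_mem _ hxg)

/-- **Regular blow-up of a centre assembled from finitely many primary pieces.** Let `B` be Noetherian, `𝔔ᵢ` (`i ∈ ι`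
finite) maximal ideals, `Iᵢ` ideals with `𝔔ᵢ^{nᵢ} ⊆ Iᵢ ⊆ 𝔔ᵢ`, `Spec B` regular at every prime different from all
`𝔔ᵢ`, and for every `i` some `g ∉ 𝔔ᵢ` lying in `I_j` for all `j ≠ i` with `Bl_{Iᵢ B_g}(Spec B_g)` regular. Then
`Bl_{⨅ Iᵢ}(Spec B)` is regular. [cite: StacksProject, Tag 02OS; Tag 02NS] [cite: GortzWedhorn2020, Prop. 13.91 (2)] -/
theorem isRegular_affineBlowup_iInf {B : Type} [CommRing B] [IsNoetherianRing B] {ι : Type} [Fintype ι]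
    [DecidableEq ι] (𝔔 : ι → Ideal B) [h𝔔 : ∀ i, (𝔔 i).IsMaximal] (I : ι → Ideal B) (n : ι → ℕ)
    (hpI : ∀ i, 𝔔 i ^ n i ≤ I i) (hIp : ∀ i, I i ≤ 𝔔 i)
    (hoff : ∀ x : Spec (.of B), (∀ i, x.asIdeal ≠ 𝔔 i) → x ∈ Scheme.regularLocus (Spec (.of B)))
    (hloc : ∀ i, ∃ g : B, g ∉ 𝔔 i ∧ (∀ j, j ≠ i → g ∈ I j) ∧
      Scheme.IsRegular (affineBlowup ((I i).map (algebraMap B (Localization.Away g))))) :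
    Scheme.IsRegular (affineBlowup (⨅ i, I i)) := by
  refine isRegular_affineBlowup_of_forall_maximal_le (⨅ i, I i) (fun x hx => hoff x fun i hxi => hx ?_) ?_
  · rw [hxi]
    exact (iInf_le I i).trans (hIp i)
  · intro 𝔪 h𝔪 hJ𝔪
    -- `𝔪 ⊇ ⨅ I ⇒ 𝔪 ⊇ some I_i ⊇ 𝔔_i^{n_i} ⇒ 𝔪 = 𝔔_i`
    have hinf : (Finset.univ.inf I) ≤ 𝔪 := by
      rw [Finset.inf_eq_iInf]
      refine le_trans (le_of_eq ?_) hJ𝔪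
      simp
    obtain ⟨i, -, hi⟩ := (Ideal.IsPrime.inf_le' h𝔪.isPrime).mp hinf
    have h𝔔𝔪 : 𝔔 i ≤ 𝔪 := Ideal.IsPrime.le_of_pow_le ((hpI i).trans hi)
    have heq : 𝔔 i = 𝔪 := (h𝔔 i).eq_of_le h𝔪.ne_top h𝔔𝔪
    obtain ⟨g, hg, hgI, hreg⟩ := hloc i
    refine ⟨g, heq ▸ hg, ?_⟩
    rw [map_iInf_eq_map_of_forall_mem I i hgI]
    exact hreg

end Summit.ResolutionOfSingularities.ResolutionOfSingularities.Theorems.FRationalResolution.BlowupComaximalCentres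

end
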